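import Literature.MathematicalPhysics.QuantumFieldTheory.Balaban1983to89.B4Thm112RegionLp

/-!
# `Balaban1983to89.B4Thm112RegionLpDeriv` — [Balaban1983RegularityDecay] THEOREM p. 573, (1.11)–(1.12): THE δG CLAUSE,
# DERIVATIVE MEMBER `|(D^η_{A,μ}δG_k(Ω,Ω₀,A)f)(x)|`, FOR A GENERAL PAIR `Ω ⊂ Ω₀` OF FINITE UNIONS OF `K`-BLOCKS UNDER
# `R₀`, UNIFORM IN `η` — r01 g6's general-probe δG chain `B4Ineq112LpChain.probe_delta_bound_lp` with the scaled probe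
# `η^{-1}(E_{x,x+e_μ}[U(A_{⟨x,x+e_μ⟩})] − E_{xx}[1])` on the two cube-propagator families of `B4CubeGreenRegionPair`

statement-level skeleton of published theorems with citation tags; proofs where landed; nothing here is a claim about the Yang–Mills mass gap

WHAT THIS FILE DOES.  §1 **`thm112_deriv_region_of_inputs`**: the setting of `B4Thm112RegionLp.thm112_value_region_of_inputs`
(sites of `Ω₀`, `G = pairGreen`, `G′ = G_k(Ω₀,A)`, families `atGreen₂`/`atGreenΩ`, `good j ⟺ □̂_j ⊆ Ω`) with the probe
of `B4Thm110RegionLpDeriv.thm110_deriv_region_of_inputs` (bond `⟨x, x+e_μ⟩ ⊂ Ω`; `≤ 2^{d+2}` cubes see `x` or `x+e_μ`,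
all within `(3/4)M`; the first-letter input `α_P = √N c_D + (s/K)·N·max(√N c_G, 2)` by the Leibniz rule (2.3) with
«|∂^ηh_j| ≤ O(M^{-1})» for BOTH families — at the cubes seeing the bond the families' letters coincide,
`B4CubeGreenRegionPair.letterΩ_a_eq`); `R₀` in label form with radius `K(n₀+2) + 1`.  CONCLUSION:
`|(D^η_{A,μ}G_k(Ω,A)(f|_Ω))(x)_i − (D^η_{A,μ}G_k(Ω₀,A)f)(x)_i| ≤ 2^{d+4}e^{35/8}·α_P·V·exp(−(D+D₀+D₁)/(2nK))·‖f‖_∞`.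
§2 **`thm112_deriv_region`** — hypothesis-free («e sufficiently small»), the inputs discharged as in
`B4Thm110RegionLpDeriv.thm110_deriv_region` and `B4Thm112RegionLp.thm112_value_region`.

HONEST SCOPE.  As `B4Thm112RegionLp` (cube configurations `Ã_j` at the cubes interior to `Ω`, `A` elsewhere —
DISCLOSED there; `f` on the sites of `Ω₀`, `G_k(Ω,A)` on its restriction; abelian one-parameter flow, component field,
staircase contours, `ℓ^∞` over sites and colours, the `L²`-comparison `V`, `K` existential); the bond `⟨x, x+e_μ⟩`
inside `Ω` (both covariant derivatives (1.3), on `Ω` and on `Ω₀`, then read the same link variable); only the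
DERIVATIVE member of the δG clause (value member: `B4Thm112RegionLp`; Hölder member: r01 g6's abstract
`B4Ineq112LpChainMembers.ineq112_holder_lp`, not instantiated here).  No `Prop` fact, no `sorry`; axioms standard.
-/

namespace Literature.MathematicalPhysics.QuantumFieldTheory.Balaban1983to89.B4Thm112RegionLpDeriv



open Literature.MathematicalPhysics.QuantumFieldTheory.Balaban1983to89.B4Reflection242 (boxDom mem_boxDom nbrs mem_nbrs
  blk blk_mem_boxDom)
open Literature.MathematicalPhysics.QuantumFieldTheory.Balaban1983to89.B4GaugeCovariance
open Literature.MathematicalPhysics.QuantumFieldTheory.Balaban1983to89.B4Commutators25to211 (mulH opK)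
open Literature.MathematicalPhysics.QuantumFieldTheory.Balaban1983to89.B4Lower18 (fineDom mem_fineDom IsBlockUnion)
open Literature.MathematicalPhysics.QuantumFieldTheory.Balaban1983to89.B4Lower18Regular (e1 baseEmb stairContour
  base_le_of_blk)
open Literature.MathematicalPhysics.QuantumFieldTheory.Balaban1983to89.B4Lower18RegularRegion (regWt rBlkWt rbaseEmb
  rstairContour regWt_nonneg rBlkWt_ne_zero compField)
open Literature.MathematicalPhysics.QuantumFieldTheory.Balaban1983to89.B4Lemma21Region (regionOp regionDeriv covDeriv
  fld_covDeriv_mulVec_of_mem)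
open Literature.MathematicalPhysics.QuantumFieldTheory.Balaban1983to89.B4Lemma22ReduceZero (Box opA greenA derivA)
open Literature.MathematicalPhysics.QuantumFieldTheory.Balaban1983to89.B4Lemma22Reduce231 (supN supN_nonneg)
open Literature.MathematicalPhysics.QuantumFieldTheory.Balaban1983to89.B4Lemma22EtaBox (vol vol_pos lpW lpW_nonneg)
open Literature.MathematicalPhysics.QuantumFieldTheory.Balaban1983to89.B4Lemma22LpStair (lpM lpM_nonneg)
open Literature.MathematicalPhysics.QuantumFieldTheory.Balaban1983to89.B4PartitionUnity22 (hCube hCube_nonneg hCube_le_one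
  hCube_ne_zero_imp mem_box_of_hCube_ne_zero hprof D1 D2 D1_nonneg D2_nonneg contDiff_hprof hasCompactSupport_hprof)
open Literature.MathematicalPhysics.QuantumFieldTheory.Balaban1983to89.B4Eq220PartitionSizes (hZ hBox)
open Literature.MathematicalPhysics.QuantumFieldTheory.Balaban1983to89.B4Eq220CommutatorField (kOp)
open Literature.MathematicalPhysics.QuantumFieldTheory.Balaban1983to89.B4CubeFields22 (cubeField cubeField_eq_compField)
open Literature.MathematicalPhysics.QuantumFieldTheory.Balaban1983to89.B4CubeFieldHyps22 (aSeq_window cubeField_threshold)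
open Literature.MathematicalPhysics.QuantumFieldTheory.Balaban1983to89.B4Eq220CubeField (lemma22_sup_cubeField
  eq220_cubeField_std eq221_cubeField)
open Literature.MathematicalPhysics.QuantumFieldTheory.Balaban1983to89.B4Eq221PsupCubeField (eq221_psup_cubeField_std)
open Literature.MathematicalPhysics.QuantumFieldTheory.Balaban1983to89.B4Eq221L2FactorRegion (acBond kOpR)
open Literature.MathematicalPhysics.QuantumFieldTheory.Balaban1983to89.B4Eq221HjRegion (eq221_l2_region_hZ hsizeR_hZ)
open Literature.MathematicalPhysics.QuantumFieldTheory.Balaban1983to89.B4CubeOpReindex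
open Literature.MathematicalPhysics.QuantumFieldTheory.Balaban1983to89.B4WalkRouteRegion (rpos labels labels_complete
  regWt_local rBlkWt_local green_mul_op)
open Literature.MathematicalPhysics.QuantumFieldTheory.Balaban1983to89.B4Ineq110WalkRoute (norm_mulH_le)
open Literature.MathematicalPhysics.QuantumFieldTheory.Balaban1983to89.B4Ineq110WalkRouteDeriv (unitOp_apply
  unitOp_mul_mulH norm_unitOp_le fld_bondOp_mulVec)
open Literature.MathematicalPhysics.QuantumFieldTheory.Balaban1983to89.B4Thm110BoxDerivWalk (probe_mul_mulH
  fld_probe_mulVec_self row_abs_sum_U_le)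
open Literature.MathematicalPhysics.QuantumFieldTheory.Balaban1983to89.B4RegionCubeCarrier
open Literature.MathematicalPhysics.QuantumFieldTheory.Balaban1983to89.B4CubeGreenRegion
open Literature.MathematicalPhysics.QuantumFieldTheory.Balaban1983to89.B4LpNormTransfer
open Literature.MathematicalPhysics.QuantumFieldTheory.Balaban1983to89.B4Thm110RegionLp
open Literature.MathematicalPhysics.QuantumFieldTheory.Balaban1983to89.B4Ineq110LpChain (lpv lpv_nonneg lvl lvl_zero
  lvl_succ lpv_two_le)
open Literature.MathematicalPhysics.QuantumFieldTheory.Balaban1983to89.B4Ineq112LpChain (probe_delta_bound_lp)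
open Literature.MathematicalPhysics.QuantumFieldTheory.Balaban1983to89.B4Thm110RegionLpDeriv (chainLetter chain_letter_inputs
  probe_atGreen_le)
open Literature.MathematicalPhysics.QuantumFieldTheory.Balaban1983to89.B4RegionPairGreen
open Literature.MathematicalPhysics.QuantumFieldTheory.Balaban1983to89.B4CubeGreenRegionPair
open Literature.MathematicalPhysics.QuantumFieldTheory.Balaban1983to89.B4PairLetterL2 (lpv_two_letterΩ_bad_le)
open Literature.MathematicalPhysics.QuantumFieldTheory.Balaban1983to89.B4Thm112RegionLp
open scoped Matrix
open scoped Matrix.Norms.Operator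

noncomputable section

variable {d : ℕ}

/-! ## §1. (1.11)–(1.12), derivative member, on a general pair from the per-cube inputs -/

section Inputs

variable {ι : Type} [Fintype ι] [DecidableEq ι]

/-- the labels that can see a site number at most `2^{d+1}`. [cite: Balaban1983RegularityDecay, §2 p.575] -/
private theorem card_labelBox_le (M : ℝ) (p : Fin (d + 1) → ℝ) :
    (Fintype.piFinset fun ν => ({⌊p ν / M⌋, ⌊p ν / M⌋ + 1} : Finset ℤ)).card ≤ 2 ^ (d + 1) := by
  rw [Fintype.card_piFinset]
  calc ∏ ν, ({⌊p ν / M⌋, ⌊p ν / M⌋ + 1} : Finset ℤ).card ≤ 2 ^ (Finset.univ : Finset (Fin (d + 1))).card :=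
        Finset.prod_le_pow_card _ _ 2 fun ν _ => Finset.card_le_two
    _ = 2 ^ (d + 1) := by rw [Finset.card_univ, Fintype.card_fin]

omit [Fintype ι] [DecidableEq ι] in
/-- the unit block of `x + e_μ` is within one label of that of `x`. [folklore] -/
private theorem abs_blk_add_e1_sub_le {n : ℕ} (hn : 1 ≤ n) (x : Fin (d + 1) → ℤ) (μ ν : Fin (d + 1)) :
    |blk n (x + e1 μ) ν - blk n x ν| ≤ 1 := by
  have hn0 : (0 : ℤ) < n := by exact_mod_cast hn
  by_cases hν : ν = μ
  · subst hν
    have h1 : (x + e1 ν) ν = x ν + 1 := by simp [B4Lower18Regular.e1_apply_self]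
    show |(x + e1 ν) ν / (n : ℤ) - x ν / (n : ℤ)| ≤ 1
    rw [h1, abs_le]
    constructor
    · have := Int.ediv_le_ediv hn0 (show x ν ≤ x ν + 1 by omega)
      linarith
    · have h2 : (x ν + 1) / (n : ℤ) ≤ (x ν + 1 * (n : ℤ)) / (n : ℤ) := Int.ediv_le_ediv hn0 (by nlinarith)
      rw [Int.add_mul_ediv_right _ _ hn0.ne'] at h2
      linarith
  · have h1 : (x + e1 μ) ν = x ν := by simp [B4Lower18Regular.e1_apply_ne hν]
    show |(x + e1 μ) ν / (n : ℤ) - x ν / (n : ℤ)| ≤ 1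
    rw [h1, sub_self, abs_zero]
    exact zero_le_one

omit [Fintype ι] [DecidableEq ι] in
/-- a site of the cube `□_j` (label in `[K(j−1), K(j+1))^{d+1}`) is within `M = nK` of the centre `nKj` (the chain's
`hS1`). [cite: Balaban1983RegularityDecay, §2 p.575 «□_j … a cube of the size 2M and with center in Mj»] -/
private theorem abs_rpos_sub_le_of_cubeS' {ℓ k : ℕ} (hn : 1 ≤ (ℓ + 1) ^ k) (Ω₀c : Finset (Fin (d + 1) → ℤ)) (K : ℕ)
    (j : Fin (d + 1) → ℤ) (z : ↥(fineDom ((ℓ + 1) ^ k) Ω₀c)) (hz : cubeS ℓ k Ω₀c K j z) (μ : Fin (d + 1)) :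
    |rpos ((ℓ + 1) ^ k) Ω₀c z μ - ((((ℓ + 1) ^ k : ℕ) : ℝ) * K) * j μ| ≤ (((ℓ + 1) ^ k : ℕ) : ℝ) * K := by
  have hn0 : (0 : ℤ) < ((((ℓ + 1) ^ k : ℕ)) : ℤ) := by exact_mod_cast hn
  obtain ⟨h1, h2⟩ := hz μ
  simp only [cshift] at h1 h2
  have hdiv := Int.mul_ediv_add_emod (z.1 μ) ((((ℓ + 1) ^ k : ℕ)) : ℤ)
  have hr0 := Int.emod_nonneg (z.1 μ) hn0.ne'
  have hr1 := Int.emod_lt_of_pos (z.1 μ) hn0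
  have hb : blk ((ℓ + 1) ^ k) z.1 μ = z.1 μ / ((((ℓ + 1) ^ k : ℕ)) : ℤ) := rfl
  rw [hb] at h1 h2
  have hlo : ((((ℓ + 1) ^ k : ℕ)) : ℤ) * ((K : ℤ) * (j μ - 1)) ≤ z.1 μ := by
    have := mul_le_mul_of_nonneg_left h1 hn0.le
    linarith
  have hhi : z.1 μ < ((((ℓ + 1) ^ k : ℕ)) : ℤ) * ((K : ℤ) * (j μ - 1) + 2 * K) := by
    have h2' : z.1 μ / ((((ℓ + 1) ^ k : ℕ)) : ℤ) < (K : ℤ) * (j μ - 1) + 2 * K := by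
      have := h2; simp only [Nat.cast_mul, Nat.cast_ofNat] at this; exact this
    have h3 : z.1 μ / ((((ℓ + 1) ^ k : ℕ)) : ℤ) + 1 ≤ (K : ℤ) * (j μ - 1) + 2 * K := Int.add_one_le_iff.mpr h2'
    have := mul_le_mul_of_nonneg_left h3 hn0.le
    linarith
  have hlo' : ((((ℓ + 1) ^ k : ℕ) : ℝ)) * ((K : ℝ) * ((j μ : ℝ) - 1)) ≤ ((z.1 μ : ℤ) : ℝ) := by exact_mod_cast hlo
  have hhi' : ((z.1 μ : ℤ) : ℝ) < ((((ℓ + 1) ^ k : ℕ) : ℝ)) * ((K : ℝ) * ((j μ : ℝ) - 1) + 2 * K) := by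
    exact_mod_cast hhi
  show |((z.1 μ : ℤ) : ℝ) - _| ≤ _
  rw [abs_le]
  constructor <;> nlinarith

/-- **THEOREM (1.11)–(1.12), DERIVATIVE MEMBER, ON A GENERAL PAIR `Ω ⊂ Ω₀` UNDER `R₀`, FROM THE PER-CUBE INPUTS,
UNIFORM IN `η`** (every structural hypothesis of r01 g6's `B4Ineq112LpChain.probe_delta_bound_lp` DISCHARGED).  INPUTS
as `B4Thm112RegionLp.thm112_value_region_of_inputs` plus, at the cubes interior to `Ω₀`, Lemma 2.2's derivative sup
member `‖D^η_{Ã,μ}G_k(□,Ã)Φ‖_∞ ≤ c_D‖Φ‖_∞` on the translated boxes, and `Ω₀` a union of `K`-blocks (for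
«|∂^ηh_j| ≤ O(M^{-1})», `B4Eq221HjRegion.hsizeR_hZ`).  The bond `⟨x, x+e_μ⟩ ⊂ Ω`; `R₀`: every unit label within
`K(n₀+2) + 1` of the block of `x` lies in `Ω`.  CONCLUSION for `f` on the sites of `Ω₀` supported in `P × ι`,
`‖f‖_{2,η} ≤ V‖f‖_∞`, `D`, `D₀`, `D₁` as there:
`|(D^η_{A,μ}G_k(Ω,A)(f|_Ω))(x)_i − (D^η_{A,μ}G_k(Ω₀,A)f)(x)_i|`
`≤ 2^{d+4}e^{35/8}·(√N c_D + ((d+1)(sup|h′|+sup|h″|)/K)·N·max(√N c_G, 2))·V·exp(−(D+D₀+D₁)/(2nK))·‖f‖_∞`.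
[cite: Balaban1983RegularityDecay, Theorem (1.10)–(1.12) p.573; (1.3) p.572; (2.3) p.575; (2.13) p.577; (2.17)–(2.22) pp.578–579] -/
theorem thm112_deriv_region_of_inputs (F : OrthFlow ι) (κ : ℝ) {ℓ k : ℕ} (hℓ : 1 ≤ ℓ) (hk : 1 ≤ k)
    (hn : 1 ≤ (ℓ + 1) ^ k) (Ω₀c Ωc : Finset (Fin (d + 1) → ℤ)) (hsub : Ωc ⊆ Ω₀c) {K : ℕ} (hK8 : 8 ≤ K) (hK4 : 4 ∣ K)
    (hΩ₀ : IsBlockUnion K Ω₀c) {a m2 : ℝ} (ha : 0 < a) (hm : 0 ≤ m2) (Ac : (Fin (d + 1) → ℤ) → Fin (d + 1) → ℝ)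
    {cG cK : ℝ} (hcG : 0 ≤ cG) (hcK : 0 ≤ cK) {n₀ : ℕ} (hn₀ : 0 < n₀)
    (hG : ∀ j, cubeLabels K j ⊆ Ω₀c → ∀ Φ : ↥(Box d ℓ k fun _ : Fin (d + 1) => 2 * K) × ι → ℝ,
      supN (greenA d F κ ℓ k a m2 (fun _ => 2 * K) (baseEmb hn _) (stairContour hn _) (boxFld ℓ k K Ac j) *ᵥ Φ)
        ≤ cG * supN Φ)
    (h0 : ∀ j, cubeLabels K j ⊆ Ω₀c → ∀ Φ : ↥(Box d ℓ k fun _ : Fin (d + 1) => 2 * K) × ι → ℝ,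
      supN (kOp F κ ((ℓ + 1) ^ k) (B1.aSeq a ((ℓ : ℝ) + 1) k) m2 (fun _ => 2 * K) (baseEmb hn _) (stairContour hn _)
            (boxFld ℓ k K Ac j) (hBox ((ℓ + 1) ^ k) K (fun _ => 2 * K) (fun _ => 1))
          *ᵥ (greenA d F κ ℓ k a m2 (fun _ => 2 * K) (baseEmb hn _) (stairContour hn _) (boxFld ℓ k K Ac j)
            *ᵥ (mulH (ι := ι) (hBox ((ℓ + 1) ^ k) K (fun _ => 2 * K) (fun _ => 1)) *ᵥ Φ))) ≤ cK * supN Φ)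
    (h1 : ∀ j, cubeLabels K j ⊆ Ω₀c → ∀ p : ℝ, 2 * (n₀ : ℝ) ≤ p →
      ∀ Φ : ↥(Box d ℓ k fun _ : Fin (d + 1) => 2 * K) × ι → ℝ,
      supN (kOp F κ ((ℓ + 1) ^ k) (B1.aSeq a ((ℓ : ℝ) + 1) k) m2 (fun _ => 2 * K) (baseEmb hn _) (stairContour hn _)
            (boxFld ℓ k K Ac j) (hBox ((ℓ + 1) ^ k) K (fun _ => 2 * K) (fun _ => 1))
          *ᵥ (greenA d F κ ℓ k a m2 (fun _ => 2 * K) (baseEmb hn _) (stairContour hn _) (boxFld ℓ k K Ac j)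
            *ᵥ (mulH (ι := ι) (hBox ((ℓ + 1) ^ k) K (fun _ => 2 * K) (fun _ => 1)) *ᵥ Φ))) ≤ cK * lpW d ℓ k p Φ)
    (hg : ∀ j, cubeLabels K j ⊆ Ω₀c → ∀ p q : ℝ, 1 ≤ p → p ≤ q → p⁻¹ - q⁻¹ ≤ (2 * (n₀ : ℝ))⁻¹ →
      ∀ Φ : ↥(Box d ℓ k fun _ : Fin (d + 1) => 2 * K) × ι → ℝ,
      lpW d ℓ k q (kOp F κ ((ℓ + 1) ^ k) (B1.aSeq a ((ℓ : ℝ) + 1) k) m2 (fun _ => 2 * K) (baseEmb hn _)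
            (stairContour hn _) (boxFld ℓ k K Ac j) (hBox ((ℓ + 1) ^ k) K (fun _ => 2 * K) (fun _ => 1))
          *ᵥ (greenA d F κ ℓ k a m2 (fun _ => 2 * K) (baseEmb hn _) (stairContour hn _) (boxFld ℓ k K Ac j)
            *ᵥ (mulH (ι := ι) (hBox ((ℓ + 1) ^ k) K (fun _ => 2 * K) (fun _ => 1)) *ᵥ Φ))) ≤ cK * lpW d ℓ k p Φ)
    (hb : ∀ (j : Fin (d + 1) → ℤ) (Φ : ↥(fineDom ((ℓ + 1) ^ k) (subLabels Ω₀c K j)) × ι → ℝ),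
      lpW d ℓ k 2 (opK (regWt ((ℓ + 1) ^ k) (fineDom ((ℓ + 1) ^ k) (subLabels Ω₀c K j))) m2
            (B1.aSeq a ((ℓ : ℝ) + 1) k * (((((ℓ + 1) ^ k : ℕ)) : ℝ) ^ (d + 1))⁻¹)
            (rBlkWt ((ℓ + 1) ^ k) (subLabels Ω₀c K j) (fineDom ((ℓ + 1) ^ k) (subLabels Ω₀c K j)))
            (fieldLink F κ (acBond (subLabels Ω₀c K j) Ac))
            (contourTrans (fieldLink F κ (acBond (subLabels Ω₀c K j) Ac)) (rbaseEmb hn (subLabels Ω₀c K j))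
              (rstairContour hn (subLabels Ω₀c K j)))
            (fun a : ↥(fineDom ((ℓ + 1) ^ k) (subLabels Ω₀c K j)) => hZ ((ℓ + 1) ^ k) K j a.1)
          *ᵥ ((covOp (regWt ((ℓ + 1) ^ k) (fineDom ((ℓ + 1) ^ k) (subLabels Ω₀c K j))) m2
                (B1.aSeq a ((ℓ : ℝ) + 1) k * (((((ℓ + 1) ^ k : ℕ)) : ℝ) ^ (d + 1))⁻¹)
                (rBlkWt ((ℓ + 1) ^ k) (subLabels Ω₀c K j) (fineDom ((ℓ + 1) ^ k) (subLabels Ω₀c K j)))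
                (fieldLink F κ (acBond (subLabels Ω₀c K j) Ac))
                (contourTrans (fieldLink F κ (acBond (subLabels Ω₀c K j) Ac)) (rbaseEmb hn (subLabels Ω₀c K j))
                  (rstairContour hn (subLabels Ω₀c K j))))⁻¹
            *ᵥ (mulH (ι := ι) (fun a : ↥(fineDom ((ℓ + 1) ^ k) (subLabels Ω₀c K j)) => hZ ((ℓ + 1) ^ k) K j a.1)
              *ᵥ Φ))) ≤ cK * lpW d ℓ k 2 Φ)
    (hbΩ₁ : ∀ (j : Fin (d + 1) → ℤ) (Φ : ↥(fineDom ((ℓ + 1) ^ k) (Ωc ∩ cubeLabels K j)) × ι → ℝ),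
      lpW d ℓ k 2 (opK (regWt ((ℓ + 1) ^ k) (fineDom ((ℓ + 1) ^ k) (Ωc ∩ cubeLabels K j))) m2
            (B1.aSeq a ((ℓ : ℝ) + 1) k * (((((ℓ + 1) ^ k : ℕ)) : ℝ) ^ (d + 1))⁻¹)
            (rBlkWt ((ℓ + 1) ^ k) (Ωc ∩ cubeLabels K j) (fineDom ((ℓ + 1) ^ k) (Ωc ∩ cubeLabels K j)))
            (fieldLink F κ (acBond (Ωc ∩ cubeLabels K j) Ac))
            (contourTrans (fieldLink F κ (acBond (Ωc ∩ cubeLabels K j) Ac)) (rbaseEmb hn (Ωc ∩ cubeLabels K j))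
              (rstairContour hn (Ωc ∩ cubeLabels K j)))
            (fun a : ↥(fineDom ((ℓ + 1) ^ k) (Ωc ∩ cubeLabels K j)) => hZ ((ℓ + 1) ^ k) K j a.1)
          *ᵥ ((covOp (regWt ((ℓ + 1) ^ k) (fineDom ((ℓ + 1) ^ k) (Ωc ∩ cubeLabels K j))) m2
                (B1.aSeq a ((ℓ : ℝ) + 1) k * (((((ℓ + 1) ^ k : ℕ)) : ℝ) ^ (d + 1))⁻¹)
                (rBlkWt ((ℓ + 1) ^ k) (Ωc ∩ cubeLabels K j) (fineDom ((ℓ + 1) ^ k) (Ωc ∩ cubeLabels K j)))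
                (fieldLink F κ (acBond (Ωc ∩ cubeLabels K j) Ac))
                (contourTrans (fieldLink F κ (acBond (Ωc ∩ cubeLabels K j) Ac)) (rbaseEmb hn (Ωc ∩ cubeLabels K j))
                  (rstairContour hn (Ωc ∩ cubeLabels K j))))⁻¹
            *ᵥ (mulH (ι := ι) (fun a : ↥(fineDom ((ℓ + 1) ^ k) (Ωc ∩ cubeLabels K j)) => hZ ((ℓ + 1) ^ k) K j a.1) *ᵥ Φ))) ≤ cK * lpW d ℓ k 2 Φ)
    (hbΩ₂ : ∀ (j : Fin (d + 1) → ℤ) (Φ : ↥(fineDom ((ℓ + 1) ^ k) (subLabels Ω₀c K j \ (Ωc ∩ cubeLabels K j))) × ι → ℝ),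
      lpW d ℓ k 2 (opK (regWt ((ℓ + 1) ^ k) (fineDom ((ℓ + 1) ^ k) (subLabels Ω₀c K j \ (Ωc ∩ cubeLabels K j)))) m2
            (B1.aSeq a ((ℓ : ℝ) + 1) k * (((((ℓ + 1) ^ k : ℕ)) : ℝ) ^ (d + 1))⁻¹)
            (rBlkWt ((ℓ + 1) ^ k) (subLabels Ω₀c K j \ (Ωc ∩ cubeLabels K j)) (fineDom ((ℓ + 1) ^ k) (subLabels Ω₀c K j \ (Ωc ∩ cubeLabels K j))))
            (fieldLink F κ (acBond (subLabels Ω₀c K j \ (Ωc ∩ cubeLabels K j)) Ac))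
            (contourTrans (fieldLink F κ (acBond (subLabels Ω₀c K j \ (Ωc ∩ cubeLabels K j)) Ac)) (rbaseEmb hn (subLabels Ω₀c K j \ (Ωc ∩ cubeLabels K j)))
              (rstairContour hn (subLabels Ω₀c K j \ (Ωc ∩ cubeLabels K j))))
            (fun a : ↥(fineDom ((ℓ + 1) ^ k) (subLabels Ω₀c K j \ (Ωc ∩ cubeLabels K j))) => hZ ((ℓ + 1) ^ k) K j a.1)
          *ᵥ ((covOp (regWt ((ℓ + 1) ^ k) (fineDom ((ℓ + 1) ^ k) (subLabels Ω₀c K j \ (Ωc ∩ cubeLabels K j)))) m2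
                (B1.aSeq a ((ℓ : ℝ) + 1) k * (((((ℓ + 1) ^ k : ℕ)) : ℝ) ^ (d + 1))⁻¹)
                (rBlkWt ((ℓ + 1) ^ k) (subLabels Ω₀c K j \ (Ωc ∩ cubeLabels K j)) (fineDom ((ℓ + 1) ^ k) (subLabels Ω₀c K j \ (Ωc ∩ cubeLabels K j))))
                (fieldLink F κ (acBond (subLabels Ω₀c K j \ (Ωc ∩ cubeLabels K j)) Ac))
                (contourTrans (fieldLink F κ (acBond (subLabels Ω₀c K j \ (Ωc ∩ cubeLabels K j)) Ac)) (rbaseEmb hn (subLabels Ω₀c K j \ (Ωc ∩ cubeLabels K j)))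
                  (rstairContour hn (subLabels Ω₀c K j \ (Ωc ∩ cubeLabels K j)))))⁻¹
            *ᵥ (mulH (ι := ι) (fun a : ↥(fineDom ((ℓ + 1) ^ k) (subLabels Ω₀c K j \ (Ωc ∩ cubeLabels K j))) => hZ ((ℓ + 1) ^ k) K j a.1) *ᵥ Φ))) ≤ cK * lpW d ℓ k 2 Φ)
    {cD : ℝ} (hcD : 0 ≤ cD) (μ : Fin (d + 1))
    (hDG : ∀ j, cubeLabels K j ⊆ Ω₀c → ∀ Φ : ↥(Box d ℓ k fun _ : Fin (d + 1) => 2 * K) × ι → ℝ,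
      supN (derivA d F κ ℓ k (fun _ => 2 * K) (boxFld ℓ k K Ac j) μ
        *ᵥ (greenA d F κ ℓ k a m2 (fun _ => 2 * K) (baseEmb hn _) (stairContour hn _) (boxFld ℓ k K Ac j) *ᵥ Φ))
        ≤ cD * supN Φ)
    (h3 : (3 : ℝ) ^ (d + 1) * (Real.sqrt (Fintype.card ι) * cK) ≤ Real.exp (-1))
    -- the bond in `Ω`, `R₀`, the source and the three separations
    (x : ↥(fineDom ((ℓ + 1) ^ k) Ωc)) (hxμ : x.1 + e1 μ ∈ fineDom ((ℓ + 1) ^ k) Ωc)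
    (hR₀ : ∀ y : Fin (d + 1) → ℤ, (∀ ν, |y ν - blk ((ℓ + 1) ^ k) x.1 ν| ≤ (K : ℤ) * (n₀ + 2) + 1) → y ∈ Ωc)
    (P : ↥(fineDom ((ℓ + 1) ^ k) Ω₀c) → Prop) [DecidablePred P] {D D₀ D₁ : ℝ}
    (hD : ∀ x', P x' → ∃ ν, D ≤ |rpos ((ℓ + 1) ^ k) Ω₀c (incl hn hsub x) ν - rpos ((ℓ + 1) ^ k) Ω₀c x' ν|)
    (hD₀ : ∀ x₁ : ↥(fineDom ((ℓ + 1) ^ k) Ω₀c), ¬ inReg ((ℓ + 1) ^ k) Ωc x₁ →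
      ∃ ν, D₀ ≤ |rpos ((ℓ + 1) ^ k) Ω₀c (incl hn hsub x) ν - rpos ((ℓ + 1) ^ k) Ω₀c x₁ ν|)
    (hD₁ : ∀ x', P x' → ∀ x₁ : ↥(fineDom ((ℓ + 1) ^ k) Ω₀c), ¬ inReg ((ℓ + 1) ^ k) Ωc x₁ →
      ∃ ν, D₁ ≤ |rpos ((ℓ + 1) ^ k) Ω₀c x₁ ν - rpos ((ℓ + 1) ^ k) Ω₀c x' ν|)
    (f : ↥(fineDom ((ℓ + 1) ^ k) Ω₀c) × ι → ℝ) (hfP : ∀ p, ¬ P p.1 → f p = 0) {V : ℝ} (hV : 1 ≤ V)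
    (hfV : lpv (vol d ℓ k)⁻¹ 2 f ≤ V * ‖f‖) (i : ι) :
    |(covDeriv ((ℓ + 1) ^ k) (fineDom ((ℓ + 1) ^ k) Ωc) (fieldLink F κ (acBond Ωc Ac)) μ
        *ᵥ ((regOp F κ hn Ωc m2 (B1.aSeq a ((ℓ : ℝ) + 1) k * (((((ℓ + 1) ^ k : ℕ)) : ℝ) ^ (d + 1))⁻¹) (compField Ac))⁻¹
          *ᵥ (fun q : ↥(fineDom ((ℓ + 1) ^ k) Ωc) × ι => f (incl hn hsub q.1, q.2)))) (x, i)
      - (covDeriv ((ℓ + 1) ^ k) (fineDom ((ℓ + 1) ^ k) Ω₀c) (fieldLink F κ (acBond Ω₀c Ac)) μ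
        *ᵥ ((covOp (regWt ((ℓ + 1) ^ k) (fineDom ((ℓ + 1) ^ k) Ω₀c)) m2
          (B1.aSeq a ((ℓ : ℝ) + 1) k * (((((ℓ + 1) ^ k : ℕ)) : ℝ) ^ (d + 1))⁻¹)
          (rBlkWt ((ℓ + 1) ^ k) Ω₀c (fineDom ((ℓ + 1) ^ k) Ω₀c)) (fieldLink F κ (acBond Ω₀c Ac))
          (contourTrans (fieldLink F κ (acBond Ω₀c Ac)) (rbaseEmb hn Ω₀c) (rstairContour hn Ω₀c)))⁻¹ *ᵥ f))
          (incl hn hsub x, i)|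
      ≤ 2 ^ (d + 4) * Real.exp (35 / 8)
          * (Real.sqrt (Fintype.card ι) * cD
              + ((d : ℝ) + 1) * (D1 hprof + D2 hprof) / K
                  * ((Fintype.card ι : ℝ) * max (Real.sqrt (Fintype.card ι) * cG) 2))
          * V * Real.exp (-((D + D₀ + D₁) / (2 * (((((ℓ + 1) ^ k : ℕ)) : ℝ) * K)))) * ‖f‖ := by
  classical
  have hK1 : 1 ≤ K := le_trans (by norm_num) hK8
  have hn2 : 2 ≤ (ℓ + 1) ^ k := by
    calc 2 ≤ ℓ + 1 := by omega
      _ = (ℓ + 1) ^ 1 := (pow_one _).symm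
      _ ≤ (ℓ + 1) ^ k := Nat.pow_le_pow_right (Nat.succ_pos ℓ) hk
  have hnK3 : 3 ≤ (ℓ + 1) ^ k * K := le_trans (by norm_num) (Nat.mul_le_mul hn2 hK8)
  have hnr : (1 : ℝ) ≤ ((((ℓ + 1) ^ k : ℕ)) : ℝ) := by exact_mod_cast hn
  have hn0 : (0 : ℝ) < ((((ℓ + 1) ^ k : ℕ)) : ℝ) := by positivity
  have hKr : (1 : ℝ) ≤ K := by exact_mod_cast hK1
  have hKpos : (0 : ℝ) < K := by positivity
  have hM : (0 : ℝ) < ((((ℓ + 1) ^ k : ℕ)) : ℝ) * K := by positivity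
  have hL : (1 : ℝ) < (ℓ : ℝ) + 1 := by
    have : (1 : ℝ) ≤ ℓ := by exact_mod_cast hℓ
    linarith
  have hak : 0 < B1.aSeq a ((ℓ : ℝ) + 1) k := B1.aSeq_pos ha hL hk
  have hak' : 0 < B1.aSeq a ((ℓ : ℝ) + 1) k * (((((ℓ + 1) ^ k : ℕ)) : ℝ) ^ (d + 1))⁻¹ := by positivity
  have hw : (0 : ℝ) < (vol d ℓ k)⁻¹ := inv_pos.2 (vol_pos d ℓ k)
  have hN : (0 : ℝ) ≤ Real.sqrt (Fintype.card ι) := Real.sqrt_nonneg _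
  have hs0 : 0 ≤ ((d : ℝ) + 1) * (D1 hprof + D2 hprof) := by
    have := D1_nonneg contDiff_hprof hasCompactSupport_hprof
    have := D2_nonneg contDiff_hprof hasCompactSupport_hprof
    positivity
  -- the four chain inputs of the first family on `Ω₀`, the support of `h_j`
  obtain ⟨Hγ, H0, Hgr, H2⟩ := chain_letter_inputs F κ hℓ hk hn Ω₀c hK8 ha hm Ac hcG hcK hn₀ hG h0 h1 hg hb
  have hsupp : ∀ (j : Fin (d + 1) → ℤ) (z : ↥(fineDom ((ℓ + 1) ^ k) Ω₀c)),
      hCube (((((ℓ + 1) ^ k : ℕ)) : ℝ) * K) j (rpos ((ℓ + 1) ^ k) Ω₀c z) ≠ 0 → cubeS ℓ k Ω₀c K j z :=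
    fun j z hz => cubeS_of_hCube_ne_zero ℓ k Ω₀c hK1 j z hz
  have heI : ∀ j : Fin (d + 1) → ℤ, Function.Injective (incl hn (subLabels_subset Ω₀c K j)) :=
    fun j => incl_injective hn _
  have hgood₀ : ∀ {j : Fin (d + 1) → ℤ}, cubeLabels K j ⊆ Ωc → cubeLabels K j ⊆ Ω₀c := fun h => h.trans hsub
  -- the bond `⟨x, y⟩` read on the sites of `Ω₀`
  set xx : ↥(fineDom ((ℓ + 1) ^ k) Ω₀c) := incl hn hsub x with hxx
  have hxxμ : xx.1 + e1 μ ∈ fineDom ((ℓ + 1) ^ k) Ω₀c := fineDom_mono hn hsub hxμ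
  set yy : ↥(fineDom ((ℓ + 1) ^ k) Ω₀c) := ⟨xx.1 + e1 μ, hxxμ⟩ with hyy
  set y : ↥(fineDom ((ℓ + 1) ^ k) Ωc) := ⟨x.1 + e1 μ, hxμ⟩ with hy
  have hyn : yy.1 ∈ nbrs xx.1 := mem_nbrs.2 ⟨μ, Or.inl rfl⟩
  have hxy : ∀ ν, |rpos ((ℓ + 1) ^ k) Ω₀c xx ν - rpos ((ℓ + 1) ^ k) Ω₀c yy ν| ≤ 1 / 8 * (((((ℓ + 1) ^ k : ℕ)) : ℝ) * K) := by
    refine regWt_local hn Ω₀c hK8 xx yy ?_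
    unfold regWt
    rw [if_pos hyn, mul_one]
    positivity
  -- abbreviations
  set hh : (Fin (d + 1) → ℤ) → ↥(fineDom ((ℓ + 1) ^ k) Ω₀c) → ℝ :=
    fun j z => hCube (((((ℓ + 1) ^ k : ℕ)) : ℝ) * K) j (rpos ((ℓ + 1) ^ k) Ω₀c z) with hhh
  have hh_abs : ∀ j z, |hh j z| ≤ 1 := fun j z => by
    rw [hhh, abs_of_nonneg (hCube_nonneg _ _ _)]; exact hCube_le_one _ _ _
  set Wxy : Matrix ι ι ℝ := fieldLink F κ (acBond Ω₀c Ac) xx yy with hWxy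
  set Pr : Matrix (↥(fineDom ((ℓ + 1) ^ k) Ω₀c) × ι) (↥(fineDom ((ℓ + 1) ^ k) Ω₀c) × ι) ℝ :=
    ((((ℓ + 1) ^ k : ℕ)) : ℝ) • (unitOp xx yy Wxy - unitOp xx xx (1 : Matrix ι ι ℝ)) with hPr
  have hwN : ∀ k', ∑ k'', |Wxy k' k''| ≤ (Fintype.card ι : ℝ) := fun k' => row_abs_sum_U_le F _ k'
  set s := labels (((((ℓ + 1) ^ k : ℕ)) : ℝ) * K) ((ℓ + 1) ^ k) Ω₀c with hs_def
  -- the starting cubes: those seeing `x` or `y`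
  set S₀ : Finset ↥s := Finset.univ.filter fun j => hh j.1 xx ≠ 0 ∨ hh j.1 yy ≠ 0 with hS₀
  have hcard : S₀.card ≤ 2 ^ (d + 2) := by
    have hsub' : S₀.map (Function.Embedding.subtype (· ∈ s))
        ⊆ (Fintype.piFinset fun ν => ({⌊rpos ((ℓ + 1) ^ k) Ω₀c xx ν / (((((ℓ + 1) ^ k : ℕ)) : ℝ) * K)⌋,
            ⌊rpos ((ℓ + 1) ^ k) Ω₀c xx ν / (((((ℓ + 1) ^ k : ℕ)) : ℝ) * K)⌋ + 1} : Finset ℤ))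
          ∪ (Fintype.piFinset fun ν => ({⌊rpos ((ℓ + 1) ^ k) Ω₀c yy ν / (((((ℓ + 1) ^ k : ℕ)) : ℝ) * K)⌋,
            ⌊rpos ((ℓ + 1) ^ k) Ω₀c yy ν / (((((ℓ + 1) ^ k : ℕ)) : ℝ) * K)⌋ + 1} : Finset ℤ)) := by
      intro j hj
      obtain ⟨i', hi', rfl⟩ := Finset.mem_map.mp hj
      obtain ⟨-, hixy⟩ := Finset.mem_filter.mp hi'
      rcases hixy with hix | hiy
      · exact Finset.mem_union_left _ (mem_box_of_hCube_ne_zero hix)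
      · exact Finset.mem_union_right _ (mem_box_of_hCube_ne_zero hiy)
    calc S₀.card = (S₀.map (Function.Embedding.subtype (· ∈ s))).card := (Finset.card_map _).symm
      _ ≤ _ := Finset.card_le_card hsub'
      _ ≤ _ := Finset.card_union_le _ _
      _ ≤ 2 ^ (d + 1) + 2 ^ (d + 1) := add_le_add (card_labelBox_le _ _) (card_labelBox_le _ _)
      _ = 2 ^ (d + 2) := by ring
  have hP0 : ∀ j : ↥s, j ∉ S₀ → Pr * mulH (ι := ι) (hh j.1) = 0 := by
    intro j hj
    have hjx : hh j.1 xx = 0 := by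
      by_contra h0'; exact hj (Finset.mem_filter.mpr ⟨Finset.mem_univ _, Or.inl h0'⟩)
    have hjy : hh j.1 yy = 0 := by
      by_contra h0'; exact hj (Finset.mem_filter.mpr ⟨Finset.mem_univ _, Or.inr h0'⟩)
    rw [hPr, probe_mul_mulH, hjx, hjy, sub_zero, mul_zero, zero_smul, zero_smul, add_zero]
  -- the cubes seeing `x` or `y` contain both in their `¾M`-core
  have hcore : ∀ j : Fin (d + 1) → ℤ, (hh j xx ≠ 0 ∨ hh j yy ≠ 0) →
      (∀ ν, |rpos ((ℓ + 1) ^ k) Ω₀c xx ν - (((((ℓ + 1) ^ k : ℕ)) : ℝ) * K) * j ν| < 3 / 4 * (((((ℓ + 1) ^ k : ℕ)) : ℝ) * K)) ∧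
      (∀ ν, |rpos ((ℓ + 1) ^ k) Ω₀c yy ν - (((((ℓ + 1) ^ k : ℕ)) : ℝ) * K) * j ν| ≤ 3 / 4 * (((((ℓ + 1) ^ k : ℕ)) : ℝ) * K)) := by
    intro j hj
    rcases hj with hjx | hjy
    · refine ⟨fun ν => (hCube_ne_zero_imp hM hjx ν).trans (by nlinarith), fun ν => ?_⟩
      have h1 := hCube_ne_zero_imp hM hjx ν
      have h2 := hxy ν
      rw [abs_sub_comm] at h2
      calc |rpos ((ℓ + 1) ^ k) Ω₀c yy ν - (((((ℓ + 1) ^ k : ℕ)) : ℝ) * K) * j ν|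
          ≤ |rpos ((ℓ + 1) ^ k) Ω₀c yy ν - rpos ((ℓ + 1) ^ k) Ω₀c xx ν|
            + |rpos ((ℓ + 1) ^ k) Ω₀c xx ν - (((((ℓ + 1) ^ k : ℕ)) : ℝ) * K) * j ν| := abs_sub_le _ _ _
        _ ≤ 1 / 8 * (((((ℓ + 1) ^ k : ℕ)) : ℝ) * K) + 5 / 8 * (((((ℓ + 1) ^ k : ℕ)) : ℝ) * K) := add_le_add h2 h1.le
        _ = 3 / 4 * (((((ℓ + 1) ^ k : ℕ)) : ℝ) * K) := by ring
    · refine ⟨fun ν => ?_, fun ν => (hCube_ne_zero_imp hM hjy ν).le.trans (by nlinarith)⟩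
      have h1 := hCube_ne_zero_imp hM hjy ν
      have h2 := hxy ν
      calc |rpos ((ℓ + 1) ^ k) Ω₀c xx ν - (((((ℓ + 1) ^ k : ℕ)) : ℝ) * K) * j ν|
          ≤ |rpos ((ℓ + 1) ^ k) Ω₀c xx ν - rpos ((ℓ + 1) ^ k) Ω₀c yy ν|
            + |rpos ((ℓ + 1) ^ k) Ω₀c yy ν - (((((ℓ + 1) ^ k : ℕ)) : ℝ) * K) * j ν| := abs_sub_le _ _ _
        _ < 1 / 8 * (((((ℓ + 1) ^ k : ℕ)) : ℝ) * K) + 5 / 8 * (((((ℓ + 1) ^ k : ℕ)) : ℝ) * K) := add_lt_add_of_le_of_lt h2 h1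
        _ = 3 / 4 * (((((ℓ + 1) ^ k : ℕ)) : ℝ) * K) := by ring
  have hS₀ρ : ∀ j ∈ S₀, ∀ ν, |rpos ((ℓ + 1) ^ k) Ω₀c xx ν - (((((ℓ + 1) ^ k : ℕ)) : ℝ) * K) * j.1 ν|
      < 3 / 4 * (((((ℓ + 1) ^ k : ℕ)) : ℝ) * K) := fun j hj => (hcore j.1 (Finset.mem_filter.mp hj).2).1
  -- `R₀`: the cubes seeing `x` or `y` and their `n₀`-neighbours are interior to `Ω`
  have hRx : ∀ y' : Fin (d + 1) → ℤ, (∀ ν, |y' ν - blk ((ℓ + 1) ^ k) x.1 ν| ≤ (K : ℤ) * (n₀ + 2)) → y' ∈ Ωc :=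
    fun y' hy' => hR₀ y' fun ν => (hy' ν).trans (by linarith)
  have hRy : ∀ y' : Fin (d + 1) → ℤ, (∀ ν, |y' ν - blk ((ℓ + 1) ^ k) y.1 ν| ≤ (K : ℤ) * (n₀ + 2)) → y' ∈ Ωc := by
    intro y' hy'
    refine hR₀ y' fun ν => ?_
    have h1 := hy' ν
    have h2 := abs_blk_add_e1_sub_le hn x.1 μ ν
    calc |y' ν - blk ((ℓ + 1) ^ k) x.1 ν|
        = |(y' ν - blk ((ℓ + 1) ^ k) y.1 ν) + (blk ((ℓ + 1) ^ k) (x.1 + e1 μ) ν - blk ((ℓ + 1) ^ k) x.1 ν)| := by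
          rw [hy]; ring_nf
      _ ≤ |y' ν - blk ((ℓ + 1) ^ k) y.1 ν| + |blk ((ℓ + 1) ^ k) (x.1 + e1 μ) ν - blk ((ℓ + 1) ^ k) x.1 ν| :=
          abs_add_le _ _
      _ ≤ (K : ℤ) * (n₀ + 2) + 1 := add_le_add h1 h2
  have hgood : ∀ j : Fin (d + 1) → ℤ, (hh j xx ≠ 0 ∨ hh j yy ≠ 0) → ∀ l : Fin (d + 1) → ℤ,
      (∀ ν, |j ν - l ν| ≤ (n₀ : ℤ)) → cubeLabels K l ⊆ Ωc := by
    intro j hj l hjl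
    rcases hj with hjx | hjy
    · exact good_of_R0 ℓ k Ωc hK8 n₀ x hRx j hjx l hjl
    · exact good_of_R0 ℓ k Ωc hK8 n₀ y hRy j hjy l hjl
  have hgoodS₀ : ∀ j ∈ S₀, cubeLabels K j.1 ⊆ Ωc := fun j hj =>
    hgood j.1 (Finset.mem_filter.mp hj).2 j.1 fun ν => by simp
  have hR₀' : ∀ j ∈ S₀, ∀ l : ↥s, (∀ ν, |j.1 ν - l.1 ν| ≤ (n₀ : ℤ)) → cubeLabels K l.1 ⊆ Ωc :=
    fun j hj l hjl => hgood j.1 (Finset.mem_filter.mp hj).2 l.1 hjl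
  -- the first-letter input `α_P` by the Leibniz rule (2.3), first family (= `Ω₀`'s `atGreen` at the cubes seeing the bond)
  set γ : ℝ := max (Real.sqrt (Fintype.card ι) * cG) 2 with hγ
  have hγ0 : 0 ≤ γ := le_max_of_le_right zero_le_two
  set αP : ℝ := Real.sqrt (Fintype.card ι) * cD
    + ((d : ℝ) + 1) * (D1 hprof + D2 hprof) / K * ((Fintype.card ι : ℝ) * γ) with hαP
  have hαP0 : 0 ≤ αP := by positivity
  have hαPj0 : ∀ j ∈ S₀, ‖Pr * (mulH (ι := ι) (hh j.1) * atGreen F κ ℓ k Ω₀c K Ac a m2 j.1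
      * mulH (ι := ι) (hh j.1))‖ ≤ αP := by
    intro j hj
    have hgj := hgood₀ (hgoodS₀ j hj)
    have hsee := (Finset.mem_filter.mp hj).2
    have hpl := hcore j.1 hsee
    have hMh : ‖mulH (ι := ι) (hh j.1)‖ ≤ 1 := norm_mulH_le _ zero_le_one (hh_abs j.1)
    have hGn : ‖atGreen F κ ℓ k Ω₀c K Ac a m2 j.1‖ ≤ γ := Hγ j.1 hgj
    have hE : ‖unitOp xx yy Wxy‖ ≤ (Fintype.card ι : ℝ) := norm_unitOp_le xx yy Wxy (Nat.cast_nonneg _) hwN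
    have hgrad : |((((ℓ + 1) ^ k : ℕ)) : ℝ) * (hh j.1 yy - hh j.1 xx)| ≤ ((d : ℝ) + 1) * (D1 hprof + D2 hprof) / K := by
      rw [abs_mul, abs_of_pos hn0]
      have h1 := (hsizeR_hZ hn hnK3 hΩ₀ j.1).grad_le xx yy hyn
      simp only [hhh, hCube_rpos_eq_hZ] at h1 ⊢
      exact h1
    have hfirst : |hh j.1 xx| * ‖Pr * atGreen F κ ℓ k Ω₀c K Ac a m2 j.1 * mulH (ι := ι) (hh j.1)‖
        ≤ Real.sqrt (Fintype.card ι) * cD := by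
      have hPG : ‖Pr * atGreen F κ ℓ k Ω₀c K Ac a m2 j.1‖ ≤ Real.sqrt (Fintype.card ι) * cD :=
        probe_atGreen_le F κ hn Ω₀c hK1 Ac a m2 hgj μ xx hxxμ (fun ν => (hpl.1 ν).le) hpl.2 hcD (hDG j.1 hgj)
      calc |hh j.1 xx| * ‖Pr * atGreen F κ ℓ k Ω₀c K Ac a m2 j.1 * mulH (ι := ι) (hh j.1)‖
          ≤ 1 * (‖Pr * atGreen F κ ℓ k Ω₀c K Ac a m2 j.1‖ * ‖mulH (ι := ι) (hh j.1)‖) :=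
            mul_le_mul (hh_abs j.1 xx) (norm_mul_le _ _) (norm_nonneg _) zero_le_one
        _ ≤ 1 * (Real.sqrt (Fintype.card ι) * cD * 1) := by
            refine mul_le_mul_of_nonneg_left (mul_le_mul hPG hMh (norm_nonneg _) (by positivity)) zero_le_one
        _ = Real.sqrt (Fintype.card ι) * cD := by ring
    have hsecond : |((((ℓ + 1) ^ k : ℕ)) : ℝ) * (hh j.1 yy - hh j.1 xx)|
        * ‖unitOp xx yy Wxy * atGreen F κ ℓ k Ω₀c K Ac a m2 j.1 * mulH (ι := ι) (hh j.1)‖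
        ≤ ((d : ℝ) + 1) * (D1 hprof + D2 hprof) / K * ((Fintype.card ι : ℝ) * γ) := by
      refine mul_le_mul hgrad ?_ (norm_nonneg _) (by positivity)
      calc ‖unitOp xx yy Wxy * atGreen F κ ℓ k Ω₀c K Ac a m2 j.1 * mulH (ι := ι) (hh j.1)‖
          ≤ ‖unitOp xx yy Wxy‖ * ‖atGreen F κ ℓ k Ω₀c K Ac a m2 j.1‖ * ‖mulH (ι := ι) (hh j.1)‖ :=
            (norm_mul_le _ _).trans (mul_le_mul_of_nonneg_right (norm_mul_le _ _) (norm_nonneg _))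
        _ ≤ (Fintype.card ι : ℝ) * γ * 1 :=
            mul_le_mul (mul_le_mul hE hGn (norm_nonneg _) (Nat.cast_nonneg _)) hMh (norm_nonneg _)
              (by positivity)
        _ = (Fintype.card ι : ℝ) * γ := mul_one _
    have hsplit : Pr * (mulH (ι := ι) (hh j.1) * atGreen F κ ℓ k Ω₀c K Ac a m2 j.1 * mulH (ι := ι) (hh j.1))
        = hh j.1 xx • (Pr * atGreen F κ ℓ k Ω₀c K Ac a m2 j.1 * mulH (ι := ι) (hh j.1))
          + (((((ℓ + 1) ^ k : ℕ)) : ℝ) * (hh j.1 yy - hh j.1 xx))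
              • (unitOp xx yy Wxy * atGreen F κ ℓ k Ω₀c K Ac a m2 j.1 * mulH (ι := ι) (hh j.1)) := by
      rw [show Pr * (mulH (ι := ι) (hh j.1) * atGreen F κ ℓ k Ω₀c K Ac a m2 j.1 * mulH (ι := ι) (hh j.1))
          = Pr * mulH (ι := ι) (hh j.1) * atGreen F κ ℓ k Ω₀c K Ac a m2 j.1 * mulH (ι := ι) (hh j.1) by
            simp only [Matrix.mul_assoc],
        hPr, probe_mul_mulH]
      simp only [Matrix.add_mul, Matrix.smul_mul]
    rw [hsplit]
    refine (norm_add_le _ _).trans ?_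
    rw [norm_smul, norm_smul, Real.norm_eq_abs, Real.norm_eq_abs, hαP]
    exact add_le_add hfirst hsecond
  -- both families at the cubes seeing the bond
  have hαPj : ∀ j ∈ S₀, ‖Pr * (mulH (ι := ι) (hh j.1) * atGreen₂ F κ ℓ k Ω₀c Ωc hsub K Ac a m2 j.1
      * mulH (ι := ι) (hh j.1))‖ ≤ αP := by
    intro j hj
    rw [atGreen₂_good F κ ℓ k Ω₀c Ωc hsub K Ac a m2 (hgoodS₀ j hj)]
    exact hαPj0 j hj
  have hαPΩj : ∀ j ∈ S₀, ‖Pr * (mulH (ι := ι) (hh j.1) * atGreenΩ F κ ℓ k Ω₀c Ωc hsub K Ac a m2 j.1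
      * mulH (ι := ι) (hh j.1))‖ ≤ αP := by
    intro j hj
    rw [letterΩ_a_eq F κ ℓ k Ω₀c Ωc hsub K Ac a m2 (hgoodS₀ j hj) _ (hsupp j.1)]
    exact hαPj0 j hj
  -- the letters of both families (as in the value member)
  have hL2 : ∀ {j : Fin (d + 1) → ℤ} (hj : cubeLabels K j ⊆ Ωc),
      opK (cutWt (cubeS ℓ k Ω₀c K j) (regWt ((ℓ + 1) ^ k) (fineDom ((ℓ + 1) ^ k) Ω₀c))) m2
          (B1.aSeq a ((ℓ : ℝ) + 1) k * (((((ℓ + 1) ^ k : ℕ)) : ℝ) ^ (d + 1))⁻¹)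
          (rBlkWt ((ℓ + 1) ^ k) Ω₀c (fineDom ((ℓ + 1) ^ k) Ω₀c))
          (cubeW F κ ℓ k Ω₀c K (atField₂ ℓ k Ω₀c Ωc K Ac j) j) (cubeT F κ ℓ k Ω₀c K (atField₂ ℓ k Ω₀c Ωc K Ac j) j)
          (hh j) * atGreen₂ F κ ℓ k Ω₀c Ωc hsub K Ac a m2 j * mulH (ι := ι) (hh j)
      = chainLetter F κ ℓ k Ω₀c K Ac a m2 j := by
    intro j hj
    dsimp only [chainLetter]
    rw [atField₂_good ℓ k Ω₀c Ωc K Ac hj, atGreen₂_good F κ ℓ k Ω₀c Ωc hsub K Ac a m2 hj]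
  have hLΩ : ∀ {j : Fin (d + 1) → ℤ} (hj : cubeLabels K j ⊆ Ωc),
      opK (cutWt (cubeS ℓ k Ω₀c K j) (cOmega ℓ k Ω₀c Ωc)) m2
          (B1.aSeq a ((ℓ : ℝ) + 1) k * (((((ℓ + 1) ^ k : ℕ)) : ℝ) ^ (d + 1))⁻¹)
          (rBlkWt ((ℓ + 1) ^ k) Ω₀c (fineDom ((ℓ + 1) ^ k) Ω₀c))
          (cubeW F κ ℓ k Ω₀c K (atField₂ ℓ k Ω₀c Ωc K Ac j) j) (cubeT F κ ℓ k Ω₀c K (atField₂ ℓ k Ω₀c Ωc K Ac j) j)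
          (hh j) * atGreenΩ F κ ℓ k Ω₀c Ωc hsub K Ac a m2 j * mulH (ι := ι) (hh j)
      = chainLetter F κ ℓ k Ω₀c K Ac a m2 j := by
    intro j hj
    dsimp only [chainLetter]
    exact letterΩ_b_eq F κ ℓ k Ω₀c Ωc hsub K Ac a m2 hj _ (hsupp j)
  have hLI : ∀ {j : Fin (d + 1) → ℤ} (hj : ¬ cubeLabels K j ⊆ Ωc) (g : ↥(fineDom ((ℓ + 1) ^ k) Ω₀c) × ι → ℝ),
      lpv (vol d ℓ k)⁻¹ 2 ((opK (cutWt (cubeS ℓ k Ω₀c K j) (regWt ((ℓ + 1) ^ k) (fineDom ((ℓ + 1) ^ k) Ω₀c))) m2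
          (B1.aSeq a ((ℓ : ℝ) + 1) k * (((((ℓ + 1) ^ k : ℕ)) : ℝ) ^ (d + 1))⁻¹)
          (rBlkWt ((ℓ + 1) ^ k) Ω₀c (fineDom ((ℓ + 1) ^ k) Ω₀c))
          (cubeW F κ ℓ k Ω₀c K (atField₂ ℓ k Ω₀c Ωc K Ac j) j) (cubeT F κ ℓ k Ω₀c K (atField₂ ℓ k Ω₀c Ωc K Ac j) j)
          (hh j) * atGreen₂ F κ ℓ k Ω₀c Ωc hsub K Ac a m2 j * mulH (ι := ι) (hh j)) *ᵥ g)
      ≤ Real.sqrt (Fintype.card ι) * cK * lpv (vol d ℓ k)⁻¹ 2 g := by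
    intro j hj g
    rw [atField₂_bad ℓ k Ω₀c Ωc K Ac hj, atGreen₂_bad F κ ℓ k Ω₀c Ωc hsub K Ac a m2 hj,
      cube_letter_b_I F κ ℓ k Ω₀c K m2 _ _ j _ (hsupp j), hCube_incl ℓ k Ω₀c K j, lpv_pad_mulVec (heI j) two_pos]
    have hin := hb j (fun q : ↥(fineDom ((ℓ + 1) ^ k) (subLabels Ω₀c K j)) × ι =>
      g (incl hn (subLabels_subset Ω₀c K j) q.1, q.2))
    rw [Matrix.mulVec_mulVec, Matrix.mulVec_mulVec] at hin
    refine (lpv_bound_of_lpW_bound d ℓ k two_pos le_rfl hcK hin).trans ?_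
    exact mul_le_mul_of_nonneg_left (lpv_res_le (heI j) hw.le two_pos g) (by positivity)
  -- THE PROBE CHAIN
  have main := probe_delta_bound_lp (X := ↥(fineDom ((ℓ + 1) ^ k) Ω₀c)) (Y := ↥Ω₀c) (κ := ι) hM
    (rpos ((ℓ + 1) ^ k) Ω₀c) (regWt ((ℓ + 1) ^ k) (fineDom ((ℓ + 1) ^ k) Ω₀c)) m2
    (B1.aSeq a ((ℓ : ℝ) + 1) k * (((((ℓ + 1) ^ k : ℕ)) : ℝ) ^ (d + 1))⁻¹)
    (rBlkWt ((ℓ + 1) ^ k) Ω₀c (fineDom ((ℓ + 1) ^ k) Ω₀c)) (fieldLink F κ (acBond Ω₀c Ac))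
    (contourTrans (fieldLink F κ (acBond Ω₀c Ac)) (rbaseEmb hn Ω₀c) (rstairContour hn Ω₀c))
    (fun x z' h μ => regWt_local hn Ω₀c hK8 x z' h μ)
    (fun y x z' h h' μ => rBlkWt_local hn Ω₀c hK8 y x z' h h' μ)
    s (fun j z h => labels_complete Ω₀c _ j z h)
    (fun j => cubeS ℓ k Ω₀c K j) (fun j z hz => inBox_of_near hn hK1 j z hz)
    (fun j z hz μ => abs_rpos_sub_le_of_cubeS' hn Ω₀c K j z hz μ)
    (fun j y z z' hz hz' => inBox_iff_of_rBlkWt _ _ hz hz')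
    (fun j => cubeW F κ ℓ k Ω₀c K (atField₂ ℓ k Ω₀c Ωc K Ac j) j)
    (fun j => cubeT F κ ℓ k Ω₀c K (atField₂ ℓ k Ω₀c Ωc K Ac j) j)
    (fun j x z' hx hz' => cubeW_window F κ ℓ k Ω₀c hK1 j hx hz' (atField₂_core ℓ k Ω₀c Ωc Ac hK1 j x z' hx hz'))
    (fun j y x hyx hx => cubeT_window F κ ℓ k Ω₀c hK1 hK4 j
      (fun u v hu hv _ => atField₂_core ℓ k Ω₀c Ωc Ac hK1 j u v hu hv) y x hyx hx)
    (inReg ((ℓ + 1) ^ k) Ωc)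
    (atGreen₂ F κ ℓ k Ω₀c Ωc hsub K Ac a m2) (fun j _ => atGreen₂_mul F κ ℓ k Ω₀c Ωc hsub K Ac hℓ hk ha hm j)
    (atGreenΩ F κ ℓ k Ω₀c Ωc hsub K Ac a m2) (fun j _ => atGreenΩ_mul F κ ℓ k Ω₀c Ωc hsub K Ac hℓ hk ha hm j)
    (pairGreen F κ hn Ω₀c Ωc hsub m2 _ (compField Ac)) (pairGreen_mul F κ hn Ω₀c Ωc hsub hak' hm (compField Ac))
    _ (green_mul_op hn Ω₀c F κ hak' hm (regWt ((ℓ + 1) ^ k) (fineDom ((ℓ + 1) ^ k) Ω₀c)) (regWt_nonneg _ _)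
      (fun _ _ _ => rfl) (acBond Ω₀c Ac))
    Pr S₀ (m₀ := 2 ^ (d + 2)) hcard hP0 xx (ρ := 3 / 4) hS₀ρ
    (fun j => cubeLabels K j ⊆ Ωc) (β := Real.sqrt (Fintype.card ι) * cK) (w := (vol d ℓ k)⁻¹)
    hn₀ hw hαP0 (by positivity) hαPj hαPΩj
    (fun jj hj => by rw [hL2 hj]; exact H0 jj.1 (hgood₀ hj))
    (fun jj hj => by rw [hLΩ hj]; exact H0 jj.1 (hgood₀ hj))
    (fun jj hj t ht1 ht2 g => by rw [hL2 hj]; exact Hgr jj.1 (hgood₀ hj) t ht1 ht2 g)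
    (fun jj hj t ht1 ht2 g => by rw [hLΩ hj]; exact Hgr jj.1 (hgood₀ hj) t ht1 ht2 g)
    (fun jj g => by
      by_cases hj : cubeLabels K jj.1 ⊆ Ωc
      · rw [hL2 hj]; exact H2 jj.1 g
      · exact hLI hj g)
    (fun jj g => by
      by_cases hj : cubeLabels K jj.1 ⊆ Ωc
      · rw [hLΩ hj]; exact H2 jj.1 g
      · exact lpv_two_letterΩ_bad_le F κ ℓ k Ω₀c Ωc hsub K Ac hK1 hj hcK (hbΩ₁ jj.1) (hbΩ₂ jj.1) g)
    h3 hR₀' P hD hD₀ hD₁ f hfP hV hfV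
  -- the entries: `(P·G f)(x) = (D^η_{A,μ}G_k(Ω,A)(f|_Ω))(x)`, `(P·G′f)(x) = (D^η_{A,μ}G_k(Ω₀,A)f)(x)`
  set G' := (covOp (regWt ((ℓ + 1) ^ k) (fineDom ((ℓ + 1) ^ k) Ω₀c)) m2
      (B1.aSeq a ((ℓ : ℝ) + 1) k * (((((ℓ + 1) ^ k : ℕ)) : ℝ) ^ (d + 1))⁻¹)
      (rBlkWt ((ℓ + 1) ^ k) Ω₀c (fineDom ((ℓ + 1) ^ k) Ω₀c)) (fieldLink F κ (acBond Ω₀c Ac))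
      (contourTrans (fieldLink F κ (acBond Ω₀c Ac)) (rbaseEmb hn Ω₀c) (rstairContour hn Ω₀c)))⁻¹ with hG'def
  set G := pairGreen F κ hn Ω₀c Ωc hsub m2 (B1.aSeq a ((ℓ : ℝ) + 1) k * (((((ℓ + 1) ^ k : ℕ)) : ℝ) ^ (d + 1))⁻¹) (compField Ac) with hGdef
  set uΩ := (regOp F κ hn Ωc m2 (B1.aSeq a ((ℓ : ℝ) + 1) k * (((((ℓ + 1) ^ k : ℕ)) : ℝ) ^ (d + 1))⁻¹) (compField Ac))⁻¹
      *ᵥ (fun q : ↥(fineDom ((ℓ + 1) ^ k) Ωc) × ι => f (incl hn hsub q.1, q.2)) with huΩ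
  have hentry' : (covDeriv ((ℓ + 1) ^ k) (fineDom ((ℓ + 1) ^ k) Ω₀c) (fieldLink F κ (acBond Ω₀c Ac)) μ
      *ᵥ (G' *ᵥ f)) (xx, i) = (Pr *ᵥ (G' *ᵥ f)) (xx, i) := by
    have h1 := fld_covDeriv_mulVec_of_mem ((ℓ + 1) ^ k) (fieldLink F κ (acBond Ω₀c Ac)) (G' *ᵥ f) (μ := μ) hxxμ
    have h2 := fld_probe_mulVec_self xx yy Wxy ((((ℓ + 1) ^ k : ℕ)) : ℝ) (G' *ᵥ f)
    exact congrFun (h1.trans h2.symm) i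
  have hGy : fld (G *ᵥ f) yy = fld uΩ y := by
    funext i'
    exact pairGreen_mulVec_incl F κ hn Ω₀c Ωc hsub m2 _ (compField Ac) f y i'
  have hGx : fld (G *ᵥ f) xx = fld uΩ x := by
    funext i'
    exact pairGreen_mulVec_incl F κ hn Ω₀c Ωc hsub m2 _ (compField Ac) f x i'
  have hentry : (covDeriv ((ℓ + 1) ^ k) (fineDom ((ℓ + 1) ^ k) Ωc) (fieldLink F κ (acBond Ωc Ac)) μ *ᵥ uΩ) (x, i)
      = (Pr *ᵥ (G *ᵥ f)) (xx, i) := by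
    have h1 := fld_covDeriv_mulVec_of_mem ((ℓ + 1) ^ k) (fieldLink F κ (acBond Ωc Ac)) uΩ (μ := μ) hxμ
    have h2 := fld_probe_mulVec_self xx yy Wxy ((((ℓ + 1) ^ k : ℕ)) : ℝ) (G *ᵥ f)
    rw [hGy, hGx] at h2
    exact congrFun (h1.trans h2.symm) i
  rw [hentry, hentry', ← Pi.sub_apply, ← Matrix.mulVec_sub, ← Matrix.sub_mulVec, ← Real.norm_eq_abs]
  refine (norm_le_pi_norm _ (xx, i)).trans (main.trans (le_of_eq ?_))
  rw [show (3 : ℝ) / 4 + 29 / 8 = 35 / 8 by norm_num, hαP]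
  push_cast
  ring

end Inputs

/-! ## §2. (1.11)–(1.12), derivative member, hypothesis-free -/

section Standard

variable {ι : Type} [Fintype ι] [DecidableEq ι]

/-- **[B4] THEOREM p. 573, (1.11)–(1.12) — THE δG CLAUSE, DERIVATIVE MEMBER, FOR A GENERAL PAIR `Ω ⊂ Ω₀` UNDER
`R₀`, UNIFORM IN `η`, HYPOTHESIS-FREE.**  There are a cube size `K ≥ 8` (`8 ∣ K`) and `c₀ > 0` (depending on `d`, `N`,
the flow, `L` and the windows only) such that for every regularity pair `(c, β)`, `β > 0`, there is `e₁ > 0` with: for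
every step `k ≥ 1`, `a ∈ [a₋, a₊]`, `0 ≤ m² ≤ m₊²`, every pair `Ω ⊆ Ω₀` of finite unions of `K`-blocks, every `A`
regular (1.7) on `Ω₀` with `0 < e ≤ e₁`, every direction `μ` and site `x` with `x, x + e_μ ∈ Ω` and every unit label
within `K(d+3) + 1` of the block of `x` in `Ω` (`R₀`, label form), every `f : Ω₀ → ℝ^N` supported in `P` with
`D ≤ dist_∞(x, P)`, `D₀ ≤ dist_∞(x, Ω^c)`, `D₁ ≤ dist_∞(P, Ω^c)` (fine units) and `‖f‖_{2,η} ≤ V‖f‖_∞`, every colour: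
`|(D^η_{A,μ}G_k(Ω,A)(f|_Ω))(x)_i − (D^η_{A,μ}G_k(Ω₀,A)f)(x)_i| ≤ c₀·V·exp(−(D + D₀ + D₁)/(2nK))·‖f‖_∞` — for `f`
supported in `Ω` the left side is `|(D^η_{A,μ}δG_k(Ω,Ω₀,A)f)(x)_i|` (`D^η_{A,μ} = B4Lemma21Region.regionDeriv`, the
factor `η^{-1}` included; `G_k(R,A) = B4Lemma21Region.regionOp` at `a_k`).
[cite: Balaban1983RegularityDecay, Theorem p.573 (1.10)–(1.12); (1.3) p.572; §2 pp.575–579 (2.2)–(2.3), (2.13), (2.17)–(2.22); Lemma 2.1 p.577; Lemma 2.2 pp.577–578] -/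
theorem thm112_deriv_region (F : OrthFlow ι) {ℓ₁ : ℝ} (hℓ₁ : 0 ≤ ℓ₁)
    (hLip : ∀ t (v : ι → ℝ), ((F.U t - 1) *ᵥ v) ⬝ᵥ ((F.U t - 1) *ᵥ v) ≤ (ℓ₁ * t) ^ 2 * (v ⬝ᵥ v))
    (d ℓ : ℕ) (hℓ : 1 ≤ ℓ) (amin aplus m2plus : ℝ) (ha : 0 < amin) :
    ∃ K : ℕ, 8 ≤ K ∧ 8 ∣ K ∧ ∃ c₀ : ℝ, 0 < c₀ ∧ ∀ (creg β : ℝ), 0 ≤ creg → 0 < β →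
      ∃ e₁ : ℝ, 0 < e₁ ∧ ∀ (k : ℕ), 1 ≤ k → ∀ (hn : 1 ≤ (ℓ + 1) ^ k) (a m2 : ℝ),
      amin ≤ a → a ≤ aplus → 0 ≤ m2 → m2 ≤ m2plus →
      ∀ (Ω₀c Ωc : Finset (Fin (d + 1) → ℤ)), IsBlockUnion K Ω₀c → IsBlockUnion K Ωc → ∀ (hsub : Ωc ⊆ Ω₀c)
      (Ac : (Fin (d + 1) → ℤ) → Fin (d + 1) → ℝ) (e : ℝ), 0 < e → e ≤ e₁ →
        (∀ x ∈ fineDom ((ℓ + 1) ^ k) Ω₀c, ∀ μ ν : Fin (d + 1),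
          |Ac (x + e1 μ) ν - Ac x ν| ≤ creg * e ^ (β - 1) / ((ℓ + 1) ^ k : ℕ)) →
      ∀ (μ : Fin (d + 1)) (x : ↥(fineDom ((ℓ + 1) ^ k) Ωc)), x.1 + e1 μ ∈ fineDom ((ℓ + 1) ^ k) Ωc →
        (∀ y : Fin (d + 1) → ℤ, (∀ ν, |y ν - blk ((ℓ + 1) ^ k) x.1 ν| ≤ (K : ℤ) * (d + 3) + 1) → y ∈ Ωc) →
      ∀ (P : ↥(fineDom ((ℓ + 1) ^ k) Ω₀c) → Prop) [DecidablePred P] (D D₀ D₁ : ℝ),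
        (∀ x', P x' → ∃ μ, D ≤ |rpos ((ℓ + 1) ^ k) Ω₀c (incl hn hsub x) μ - rpos ((ℓ + 1) ^ k) Ω₀c x' μ|) →
        (∀ x₁ : ↥(fineDom ((ℓ + 1) ^ k) Ω₀c), ¬ inReg ((ℓ + 1) ^ k) Ωc x₁ →
          ∃ μ, D₀ ≤ |rpos ((ℓ + 1) ^ k) Ω₀c (incl hn hsub x) μ - rpos ((ℓ + 1) ^ k) Ω₀c x₁ μ|) →
        (∀ x', P x' → ∀ x₁ : ↥(fineDom ((ℓ + 1) ^ k) Ω₀c), ¬ inReg ((ℓ + 1) ^ k) Ωc x₁ →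
          ∃ μ, D₁ ≤ |rpos ((ℓ + 1) ^ k) Ω₀c x₁ μ - rpos ((ℓ + 1) ^ k) Ω₀c x' μ|) →
      ∀ (f : ↥(fineDom ((ℓ + 1) ^ k) Ω₀c) × ι → ℝ), (∀ p, ¬ P p.1 → f p = 0) →
      ∀ (V : ℝ), 1 ≤ V → lpv (vol d ℓ k)⁻¹ 2 f ≤ V * ‖f‖ →
      ∀ i : ι,
        |(regionDeriv F e ((ℓ + 1) ^ k) Ωc Ac μ
              *ᵥ ((regionOp F e hn (B1.aSeq a ((ℓ : ℝ) + 1) k) m2 Ωc Ac)⁻¹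
                *ᵥ (fun q : ↥(fineDom ((ℓ + 1) ^ k) Ωc) × ι => f (incl hn hsub q.1, q.2)))) (x, i)
          - (regionDeriv F e ((ℓ + 1) ^ k) Ω₀c Ac μ
              *ᵥ ((regionOp F e hn (B1.aSeq a ((ℓ : ℝ) + 1) k) m2 Ω₀c Ac)⁻¹ *ᵥ f)) (incl hn hsub x, i)|
          ≤ c₀ * V * Real.exp (-((D + D₀ + D₁) / (2 * ((((ℓ + 1) ^ k : ℕ) : ℝ) * K)))) * ‖f‖ := by
  -- the constants of the per-cube inputs (Lemma 2.2 at `Ã_j`, (2.20), (2.21), the graded factor; Lemma 2.1)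
  obtain ⟨C₁, hC₁, h₁⟩ := lemma22_sup_cubeField F hℓ₁ hLip d ℓ hℓ amin aplus m2plus ha
  obtain ⟨C₂, hC₂, h₂⟩ := eq220_cubeField_std F hℓ₁ hLip d ℓ hℓ amin aplus m2plus ha
  have hp₁ : (d : ℝ) + 1 < 2 * ((d : ℝ) + 1) := by
    have : (0 : ℝ) ≤ d := Nat.cast_nonneg d
    linarith
  obtain ⟨C₃, hC₃, h₃⟩ := eq221_cubeField F hℓ₁ hLip d ℓ hℓ amin aplus m2plus ha hp₁
  obtain ⟨C₄, hC₄, h₄⟩ := eq221_psup_cubeField_std F hℓ₁ hLip d ℓ hℓ amin aplus m2plus ha hp₁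
  have hs : 0 ≤ ((d : ℝ) + 1) * (D1 hprof + D2 hprof) := by
    have := D1_nonneg contDiff_hprof hasCompactSupport_hprof
    have := D2_nonneg contDiff_hprof hasCompactSupport_hprof
    positivity
  have hγ₀ : 0 < min 2 (3 / 4 * amin) / 4 := div_pos (lt_min two_pos (by linarith)) four_pos
  set C₅ : ℝ := (2 * ((d : ℝ) + 1) * (Real.sqrt (min 2 (3 / 4 * amin) / 4))⁻¹
      + (1 + |aplus|) * (min 2 (3 / 4 * amin) / 4)⁻¹) * (((d : ℝ) + 1) * (D1 hprof + D2 hprof)) with hC₅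
  have hC₅0 : 0 ≤ C₅ := by
    have : 0 ≤ (Real.sqrt (min 2 (3 / 4 * amin) / 4))⁻¹ := inv_nonneg.2 (Real.sqrt_nonneg _)
    have : 0 ≤ (min 2 (3 / 4 * amin) / 4)⁻¹ := inv_nonneg.2 hγ₀.le
    positivity
  set Cm : ℝ := C₂ + C₃ + C₄ + C₅ with hCm
  have hCm0 : 0 ≤ Cm := by positivity
  -- the cube size: `3^{d+1}·√N·C_max/K ≤ e^{−1}`, `8 ∣ K`
  set X : ℝ := (3 : ℝ) ^ (d + 1) * Real.sqrt (Fintype.card ι) * Cm * Real.exp 1 with hX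
  have hX0 : 0 ≤ X := by positivity
  set K : ℕ := 8 * (⌈X⌉₊ + 1) with hK
  have hK8 : 8 ≤ K := by omega
  have h8 : 8 ∣ K := ⟨⌈X⌉₊ + 1, rfl⟩
  have hK4 : 4 ∣ K := ⟨2 * (⌈X⌉₊ + 1), by omega⟩
  have hK2 : 2 ≤ K := by omega
  have hK1 : 1 ≤ K := by omega
  have hKr : (0 : ℝ) < K := by exact_mod_cast hK1
  have hKX : X ≤ K := by
    refine (Nat.le_ceil X).trans ?_
    rw [hK]
    push_cast
    linarith [(Nat.cast_nonneg ⌈X⌉₊ : (0 : ℝ) ≤ ⌈X⌉₊)]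
  set cK : ℝ := Cm / K with hcK_def
  have hcK : 0 ≤ cK := div_nonneg hCm0 hKr.le
  have h3 : (3 : ℝ) ^ (d + 1) * (Real.sqrt (Fintype.card ι) * cK) ≤ Real.exp (-1) := by
    have hexp : Real.exp 1 * Real.exp (-1) = 1 := by rw [← Real.exp_add]; norm_num
    have e : (3 : ℝ) ^ (d + 1) * (Real.sqrt (Fintype.card ι) * cK) = X / K * Real.exp (-1) := by
      rw [hcK_def, hX]
      calc (3 : ℝ) ^ (d + 1) * (Real.sqrt (Fintype.card ι) * (Cm / K))
          = (3 : ℝ) ^ (d + 1) * Real.sqrt (Fintype.card ι) * Cm / K * (Real.exp 1 * Real.exp (-1)) := by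
            rw [hexp]; ring
        _ = (3 : ℝ) ^ (d + 1) * Real.sqrt (Fintype.card ι) * Cm * Real.exp 1 / K * Real.exp (-1) := by ring
    rw [e]
    have : X / K ≤ 1 := div_le_one_of_le₀ hKX (Nat.cast_nonneg K)
    calc X / K * Real.exp (-1) ≤ 1 * Real.exp (-1) := mul_le_mul_of_nonneg_right this (Real.exp_pos _).le
      _ = Real.exp (-1) := one_mul _
  have hCle : ∀ {C : ℝ}, C ≤ Cm → C / K ≤ cK := fun h => div_le_div_of_nonneg_right h hKr.le
  have hC₂le : C₂ / K ≤ cK := hCle (by rw [hCm]; linarith)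
  have hC₃le : C₃ / K ≤ cK := hCle (by rw [hCm]; linarith)
  have hC₄le : C₄ / K ≤ cK := hCle (by rw [hCm]; linarith)
  have hC₅le : C₅ / K ≤ cK := hCle (by rw [hCm]; linarith)
  -- the constant `c₀`
  set c₀ : ℝ := 2 ^ (d + 4) * Real.exp (35 / 8)
      * (Real.sqrt (Fintype.card ι) * C₁ + ((d : ℝ) + 1) * (D1 hprof + D2 hprof) / K
          * ((Fintype.card ι : ℝ) * max (Real.sqrt (Fintype.card ι) * C₁) 2)) + 1 with hc₀
  have hc₀0 : 0 < c₀ := by positivity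
  refine ⟨K, hK8, h8, c₀, hc₀0, fun creg β hcreg hβ => ?_⟩
  -- «for e sufficiently small»
  obtain ⟨e₁, he₁, h₁'⟩ := h₁ creg β hcreg hβ (2 * K) K hK1
  obtain ⟨e₂, he₂, h₂'⟩ := h₂ creg β hcreg hβ K hK2
  obtain ⟨e₃, he₃, h₃'⟩ := h₃ creg β hcreg hβ (2 * K) K hK2
  obtain ⟨e₄, he₄, h₄'⟩ := h₄ creg β hcreg hβ K hK2
  obtain ⟨e₅, he₅, h₅'⟩ := cubeField_threshold d (c := 0) (aplus := aplus) hℓ₁ le_rfl ha hcreg hβ 1 K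
  refine ⟨min (min (min e₁ e₂) (min e₃ e₄)) e₅, lt_min (lt_min (lt_min he₁ he₂) (lt_min he₃ he₄)) he₅, ?_⟩
  intro k hk hn a m2 ea1 ea2 em1 em2 Ω₀c Ωc hΩ₀ hΩ hsub Ac e he hle h17 μ x hxμ hxR P _ D D₀ D₁ hD hD₀ hD₁ f hfP V hV hfV i
  have hle₁ : e ≤ e₁ := hle.trans ((min_le_left _ _).trans ((min_le_left _ _).trans (min_le_left _ _)))
  have hle₂ : e ≤ e₂ := hle.trans ((min_le_left _ _).trans ((min_le_left _ _).trans (min_le_right _ _)))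
  have hle₃ : e ≤ e₃ := hle.trans ((min_le_left _ _).trans ((min_le_right _ _).trans (min_le_left _ _)))
  have hle₄ : e ≤ e₄ := hle.trans ((min_le_left _ _).trans ((min_le_right _ _).trans (min_le_right _ _)))
  have hle₅ : e ≤ e₅ := hle.trans (min_le_right _ _)
  have hn2 : 2 ≤ (ℓ + 1) ^ k := by
    calc 2 ≤ ℓ + 1 := by omega
      _ = (ℓ + 1) ^ 1 := (pow_one _).symm
      _ ≤ (ℓ + 1) ^ k := Nat.pow_le_pow_right (Nat.succ_pos ℓ) hk
  have hnK : 16 ≤ (ℓ + 1) ^ k * K := le_trans (by norm_num) (Nat.mul_le_mul hn2 hK8)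
  have hnK3 : 3 ≤ (ℓ + 1) ^ k * K := le_trans (by norm_num) hnK
  have ha' : 0 < a := lt_of_lt_of_le ha ea1
  have hL : (1 : ℝ) < (ℓ : ℝ) + 1 := by
    have : (1 : ℝ) ≤ ℓ := by exact_mod_cast hℓ
    linarith
  have hak : 0 < B1.aSeq a ((ℓ : ℝ) + 1) k := B1.aSeq_pos ha' hL hk
  obtain ⟨hak1, hak2⟩ := aSeq_window hℓ hk ha ea1 ea2
  have hvol : 0 ≤ (vol d ℓ k)⁻¹ ^ (2 : ℝ)⁻¹ := Real.rpow_nonneg (inv_nonneg.2 (vol_pos d ℓ k).le) _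
  -- the standard box data
  have hM1 : ∀ _i : Fin (d + 1), 1 ≤ 2 * K := fun _ => by omega
  have hMS : ∀ _i : Fin (d + 1), 2 * K ≤ 2 * K := fun _ => le_rfl
  have hKM : ∀ _i : Fin (d + 1), K ∣ 2 * K := fun _ => Dvd.intro_left 2 rfl
  have hj1 : ∀ _i : Fin (d + 1), (1 : ℤ) ≤ 1 := fun _ => le_rfl
  have hj2 : ∀ _i : Fin (d + 1), (K : ℤ) * (1 + 1) ≤ ((2 * K : ℕ) : ℤ) := fun _ => by push_cast; omega
  -- Lemma 2.1's `‖·‖_{2,2}` letter on a finite union `R ⊆ Ω₀` of `K`-blocks (the three kinds of sub-regions)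
  have hbR : ∀ (R : Finset (Fin (d + 1) → ℤ)), R ⊆ Ω₀c → IsBlockUnion K R → ∀ (j : Fin (d + 1) → ℤ)
      (Φ : ↥(fineDom ((ℓ + 1) ^ k) R) × ι → ℝ),
      lpW d ℓ k 2 (opK (regWt ((ℓ + 1) ^ k) (fineDom ((ℓ + 1) ^ k) (R))) m2
            (B1.aSeq a ((ℓ : ℝ) + 1) k * (((((ℓ + 1) ^ k : ℕ)) : ℝ) ^ (d + 1))⁻¹)
            (rBlkWt ((ℓ + 1) ^ k) (R) (fineDom ((ℓ + 1) ^ k) (R)))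
            (fieldLink F (e / ((ℓ + 1) ^ k : ℕ)) (acBond (R) Ac))
            (contourTrans (fieldLink F (e / ((ℓ + 1) ^ k : ℕ)) (acBond (R) Ac)) (rbaseEmb hn (R))
              (rstairContour hn (R)))
            (fun a : ↥(fineDom ((ℓ + 1) ^ k) (R)) => hZ ((ℓ + 1) ^ k) K j a.1)
          *ᵥ ((covOp (regWt ((ℓ + 1) ^ k) (fineDom ((ℓ + 1) ^ k) (R))) m2
                (B1.aSeq a ((ℓ : ℝ) + 1) k * (((((ℓ + 1) ^ k : ℕ)) : ℝ) ^ (d + 1))⁻¹)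
                (rBlkWt ((ℓ + 1) ^ k) (R) (fineDom ((ℓ + 1) ^ k) (R)))
                (fieldLink F (e / ((ℓ + 1) ^ k : ℕ)) (acBond (R) Ac))
                (contourTrans (fieldLink F (e / ((ℓ + 1) ^ k : ℕ)) (acBond (R) Ac)) (rbaseEmb hn (R))
                  (rstairContour hn (R))))⁻¹
            *ᵥ (mulH (ι := ι) (fun a : ↥(fineDom ((ℓ + 1) ^ k) (R)) => hZ ((ℓ + 1) ^ k) K j a.1) *ᵥ Φ))) ≤ cK * lpW d ℓ k 2 Φ := by
    intro R hR hRB j Φ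
    obtain ⟨_, hsm, _⟩ := h₅' e he hle₅ _ hak1 hak2
    have hsmall : ℓ₁ ^ 2 * (((d : ℝ) + 1) * creg * e ^ β) ^ 2 * ((d : ℝ) + 1)
        * (1 + B1.aSeq a ((ℓ : ℝ) + 1) k * ((d : ℝ) + 1)) ≤ min 2 (B1.aSeq a ((ℓ : ℝ) + 1) k) / 4 := by
      simpa only [Nat.cast_one, mul_one] using hsm
    have hL := eq221_l2_region_hZ F hℓ₁ hLip he hn hak em1 R hcreg
      (fun y hy => h17 y (fineDom_mono hn hR hy)) hsmall hnK3 hRB j Φ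
    have step : lpM 2 (kOpR F e hn (B1.aSeq a ((ℓ : ℝ) + 1) k) m2 R Ac (fun x => hZ ((ℓ + 1) ^ k) K j x.1)
        *ᵥ ((regionOp F e hn (B1.aSeq a ((ℓ : ℝ) + 1) k) m2 R Ac)⁻¹
          *ᵥ (mulH (ι := ι) (fun x : ↥(fineDom ((ℓ + 1) ^ k) R) => hZ ((ℓ + 1) ^ k) K j x.1) *ᵥ Φ)))
        ≤ cK * lpM 2 Φ := by
      refine hL.trans (mul_le_mul_of_nonneg_right ?_ (lpM_nonneg 2 Φ))
      refine le_trans ?_ hC₅le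
      rw [hC₅]
      calc (2 * ((d : ℝ) + 1) * (Real.sqrt (min 2 (B1.aSeq a ((ℓ : ℝ) + 1) k) / 4 + m2))⁻¹
            + (1 + B1.aSeq a ((ℓ : ℝ) + 1) k) * (min 2 (B1.aSeq a ((ℓ : ℝ) + 1) k) / 4 + m2)⁻¹)
            * (((d : ℝ) + 1) * (D1 hprof + D2 hprof)) / K
          = (2 * ((d : ℝ) + 1) * (Real.sqrt (min 2 (B1.aSeq a ((ℓ : ℝ) + 1) k) / 4 + m2))⁻¹
            + (1 + B1.aSeq a ((ℓ : ℝ) + 1) k) * (min 2 (B1.aSeq a ((ℓ : ℝ) + 1) k) / 4 + m2)⁻¹)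
            * (((d : ℝ) + 1) * (D1 hprof + D2 hprof)) * (K : ℝ)⁻¹ := div_eq_mul_inv _ _
        _ ≤ (2 * ((d : ℝ) + 1) * (Real.sqrt (min 2 (3 / 4 * amin) / 4))⁻¹
            + (1 + |aplus|) * (min 2 (3 / 4 * amin) / 4)⁻¹) * (((d : ℝ) + 1) * (D1 hprof + D2 hprof))
            * (K : ℝ)⁻¹ := mul_le_mul_of_nonneg_right (l2_const_le d ha hak1 hak2 em1 hs) (inv_nonneg.2 hKr.le)
        _ = _ := (div_eq_mul_inv _ _).symm
    show (vol d ℓ k)⁻¹ ^ (2 : ℝ)⁻¹ * lpM 2 _ ≤ cK * ((vol d ℓ k)⁻¹ ^ (2 : ℝ)⁻¹ * lpM 2 Φ)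
    calc (vol d ℓ k)⁻¹ ^ (2 : ℝ)⁻¹ * lpM 2 _ ≤ (vol d ℓ k)⁻¹ ^ (2 : ℝ)⁻¹ * (cK * lpM 2 Φ) :=
          mul_le_mul_of_nonneg_left step hvol
      _ = cK * ((vol d ℓ k)⁻¹ ^ (2 : ℝ)⁻¹ * lpM 2 Φ) := by ring
  -- the other two kinds of sub-regions are finite unions of `K`-blocks inside `Ω₀`
  have hsd : ∀ j : Fin (d + 1) → ℤ, IsBlockUnion K (subLabels Ω₀c K j \ (Ωc ∩ cubeLabels K j)) := by
    intro j y hy z hz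
    rw [Finset.mem_sdiff] at hy ⊢
    refine ⟨isBlockUnion_subLabels Ω₀c hK1 hΩ₀ j hy.1 hz, fun hzc => hy.2 ?_⟩
    exact isBlockUnion_subLabels Ωc hK1 hΩ j hzc hz.symm
  -- the main chain with the inputs discharged
  have main := thm112_deriv_region_of_inputs F (e / ((ℓ + 1) ^ k : ℕ)) hℓ hk hn Ω₀c Ωc hsub hK8 hK4 hΩ₀ ha' em1 Ac
    hC₁.le hcK (n₀ := d + 1) (Nat.succ_pos d)
    -- Lemma 2.2 (2.17), sup member, at `Ã_j`
    (fun j hj Φ => (h₁' k hk hn hnK a m2 ea1 ea2 em1 em2 (fun _ => 2 * K) hM1 hMS (fun _ => 1) hj1 hj2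
      (AcS ℓ k K Ac j) e he hle₁ (regular_AcS h17 hj) Φ).1)
    -- (2.20)
    (fun j hj Φ => (h₂' k hk hn hnK a m2 ea1 ea2 em1 em2 (AcS ℓ k K Ac j) e he hle₂ (regular_AcS h17 hj) Φ).trans
      (mul_le_mul_of_nonneg_right hC₂le (supN_nonneg Φ)))
    -- the graded factor `‖·‖_{∞,p₁}` of (2.21)
    (fun j hj p hp Φ => by
      have hp' : 2 * ((d : ℝ) + 1) ≤ p := by push_cast at hp; linarith
      exact (h₄' k hk hn hnK a m2 ea1 ea2 em1 em2 (AcS ℓ k K Ac j) e he hle₄ (regular_AcS h17 hj) p hp' Φ).trans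
        (mul_le_mul_of_nonneg_right hC₄le (lpW_nonneg d ℓ k p Φ)))
    -- (2.21)
    (fun j hj p q hp hpq hdiff Φ => by
      have hdiff' : p⁻¹ - q⁻¹ ≤ (2 * ((d : ℝ) + 1))⁻¹ := by push_cast at hdiff; exact hdiff
      exact (h₃' k hk hn hnK a m2 ea1 ea2 em1 em2 (fun _ => 2 * K) hM1 hMS hKM (fun _ => 1) hj1 hj2
        (AcS ℓ k K Ac j) e he hle₃ (regular_AcS h17 hj) p q hp hpq hdiff' Φ).trans
        (mul_le_mul_of_nonneg_right hC₃le (lpW_nonneg d ℓ k p Φ)))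
    -- Lemma 2.1's `‖·‖_{2,2}` on `Ω₀ ∩ □̂_j`, on `Ω ∩ □̂_j`, on `(Ω₀∖Ω) ∩ □̂_j`
    (fun j Φ => hbR (subLabels Ω₀c K j) (subLabels_subset Ω₀c K j) (isBlockUnion_subLabels Ω₀c hK1 hΩ₀ j) j Φ)
    (fun j Φ => hbR (Ωc ∩ cubeLabels K j) ((subLabels_subset Ωc K j).trans hsub)
      (isBlockUnion_subLabels Ωc hK1 hΩ j) j Φ)
    (fun j Φ => hbR (subLabels Ω₀c K j \ (Ωc ∩ cubeLabels K j))
      (Finset.sdiff_subset.trans (subLabels_subset Ω₀c K j)) (hsd j) j Φ)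
    hC₁.le μ
    -- Lemma 2.2 (2.17), derivative sup member, at `Ã_j`
    (fun j hj Φ => ((h₁' k hk hn hnK a m2 ea1 ea2 em1 em2 (fun _ => 2 * K) hM1 hMS (fun _ => 1) hj1 hj2
      (AcS ℓ k K Ac j) e he hle₁ (regular_AcS h17 hj) Φ).2 μ))
    h3 x hxμ
    (fun y hy => hxR y fun ν => by have h := hy ν; push_cast at h ⊢; linarith)
    P hD hD₀ hD₁ f hfP hV hfV i
  have hreg : ∀ (R : Finset (Fin (d + 1) → ℤ)), regionOp F e hn (B1.aSeq a ((ℓ : ℝ) + 1) k) m2 R Ac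
      = covOp (regWt ((ℓ + 1) ^ k) (fineDom ((ℓ + 1) ^ k) R)) m2
          (B1.aSeq a ((ℓ : ℝ) + 1) k * (((((ℓ + 1) ^ k : ℕ)) : ℝ) ^ (d + 1))⁻¹)
          (rBlkWt ((ℓ + 1) ^ k) R (fineDom ((ℓ + 1) ^ k) R)) (fieldLink F (e / ((ℓ + 1) ^ k : ℕ)) (acBond R Ac))
          (contourTrans (fieldLink F (e / ((ℓ + 1) ^ k : ℕ)) (acBond R Ac)) (rbaseEmb hn R)
            (rstairContour hn R)) := fun R => rfl
  have hreg' : regionOp F e hn (B1.aSeq a ((ℓ : ℝ) + 1) k) m2 Ωc Ac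
      = regOp F (e / ((ℓ + 1) ^ k : ℕ)) hn Ωc m2 (B1.aSeq a ((ℓ : ℝ) + 1) k * (((((ℓ + 1) ^ k : ℕ)) : ℝ) ^ (d + 1))⁻¹)
          (compField Ac) := rfl
  have hder : ∀ (R : Finset (Fin (d + 1) → ℤ)), regionDeriv F e ((ℓ + 1) ^ k) R Ac μ
      = covDeriv ((ℓ + 1) ^ k) (fineDom ((ℓ + 1) ^ k) R) (fieldLink F (e / ((ℓ + 1) ^ k : ℕ)) (acBond R Ac)) μ :=
    fun R => rfl
  rw [hreg', hreg Ω₀c, hder Ωc, hder Ω₀c]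
  have hV0 : 0 ≤ V := zero_le_one.trans hV
  refine main.trans ?_
  have hrest : 0 ≤ V * Real.exp (-((D + D₀ + D₁) / (2 * (((((ℓ + 1) ^ k : ℕ)) : ℝ) * K)))) * ‖f‖ := by positivity
  have hle : 2 ^ (d + 4) * Real.exp (35 / 8)
      * (Real.sqrt (Fintype.card ι) * C₁ + ((d : ℝ) + 1) * (D1 hprof + D2 hprof) / K
          * ((Fintype.card ι : ℝ) * max (Real.sqrt (Fintype.card ι) * C₁) 2)) ≤ c₀ := by
    rw [hc₀]; linarith
  calc 2 ^ (d + 4) * Real.exp (35 / 8)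
        * (Real.sqrt (Fintype.card ι) * C₁ + ((d : ℝ) + 1) * (D1 hprof + D2 hprof) / K
            * ((Fintype.card ι : ℝ) * max (Real.sqrt (Fintype.card ι) * C₁) 2))
        * V * Real.exp (-((D + D₀ + D₁) / (2 * (((((ℓ + 1) ^ k : ℕ)) : ℝ) * K)))) * ‖f‖
      = (2 ^ (d + 4) * Real.exp (35 / 8)
        * (Real.sqrt (Fintype.card ι) * C₁ + ((d : ℝ) + 1) * (D1 hprof + D2 hprof) / K
            * ((Fintype.card ι : ℝ) * max (Real.sqrt (Fintype.card ι) * C₁) 2)))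
        * (V * Real.exp (-((D + D₀ + D₁) / (2 * (((((ℓ + 1) ^ k : ℕ)) : ℝ) * K)))) * ‖f‖) := by ring
    _ ≤ c₀ * (V * Real.exp (-((D + D₀ + D₁) / (2 * (((((ℓ + 1) ^ k : ℕ)) : ℝ) * K)))) * ‖f‖) :=
        mul_le_mul_of_nonneg_right hle hrest
    _ = c₀ * V * Real.exp (-((D + D₀ + D₁) / (2 * (((((ℓ + 1) ^ k : ℕ)) : ℝ) * K)))) * ‖f‖ := by ring


end Standard

end

end Literature.MathematicalPhysics.QuantumFieldTheory.Balaban1983to89.B4Thm112RegionLpDeriv
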